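import Literature.MathematicalPhysics.QuantumLattice.PairCorrelations
import Literature.MathematicalPhysics.QuantumLattice.HubbardWave0PosSemidefProofs
import HarnessLib

/-!
# Pair correlations: Yang's one-particle reduced density matrix (`ρ₁ ≥ 0`, `tr ρ₁ = N`)

Trunk T-QLATTICE, family `hubbard`. A companion ("Proofs") file of
`Literature.MathematicalPhysics.QuantumLattice.PairCorrelations` (sibling of
`PairCorrelationsProofs`), discharging the named fact
`Literature.MathematicalPhysics.QuantumLattice.oneParticleRDM_posSemidef_trace`: for a normalised `N`-particle Fock vector `ψ`,
Yang's one-particle reduced density matrix `ρ₁(i, j) = ⟨ψ, c†_i c_j ψ⟩` (`oneParticleRDM`) is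
positive semidefinite and `tr ρ₁ = N`. This file only PROVES — it declares no definition.

## Proof architecture (standard; the `ρ₂` analogue is `HubbardWave0PosSemidefProofs`, whose
auxiliary lemmas in the namespace `Literature.Hubbard.PosSemidefTrace` are reused)

* `oneParticleRDM_eq_star_dotProduct`: since `c†_i = (c_i)ᴴ`,
  `ρ₁(i, j) = ⟨c_i ψ, c_j ψ⟩` (`PosSemidefTrace.expect_conjTranspose_mul`);
* `oneParticleRDM_posSemidef`: hence `ρ₁ = Bᴴ B` for `B(s, j) = (c_j ψ)(s)`, and `ρ₁` is
  positive semidefinite by `Matrix.posSemidef_conjTranspose_mul_self` (for every `ψ`);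
* `oneParticleRDM_trace`: `tr ρ₁ = Σ_i ‖c_i ψ‖² = N ‖ψ‖² = N`, because `Σ_i c†_i c_i` is the
  number operator (`PosSemidefTrace.sum_star_annihilation_mulVec_dotProduct_of_isNParticle`);
* `oneParticleRDM_posSemidef_trace_holds` assembles the two.

## References

* C. N. Yang, *Concept of off-diagonal long-range order and the quantum phases of liquid He and
  of superconductors*, Rev. Mod. Phys. **34** (1962) 694, §3 (bibkey `Yang1962`; the reduced
  density matrices `ρ₁`, `ρ₂` are positive semidefinite Hermitian, normalised to `Tr ρ₁ = N`,
  `Tr ρ₂ = N(N − 1)`).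
* T. Xiang, C. Wu, *D-wave Superconductivity*, CUP (2022), §1, eq. (1.69), p. 26 (bibkey
  `XiangWu2022`; "ρ and ρ₂ are semi-positive definite").
* H. Tasaki, *Physics and Mathematics of Quantum Many-Body Systems* (2020), §9.2 (fermion
  operators, the number operator).
-/

noncomputable section

namespace Literature.MathematicalPhysics.QuantumLattice

open Matrix Finset
open scoped ComplexOrder

variable {ι : Type*} [LinearOrder ι] [Fintype ι]

/-- The entries of `ρ₁` as inner products of one-hole vectors: `ρ₁(i, j) = ⟨c_i ψ, c_j ψ⟩`
(because `c†_i = (c_i)ᴴ`). Yang, Rev. Mod. Phys. 34 (1962) 694, §3. [folklore] -/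
theorem oneParticleRDM_eq_star_dotProduct (ψ : Fock ι) (i j : ι) :
    oneParticleRDM ψ i j = star (annihilation i *ᵥ ψ) ⬝ᵥ (annihilation j *ᵥ ψ) := by
  rw [oneParticleRDM_apply, ← annihilation_conjTranspose, PosSemidefTrace.expect_conjTranspose_mul]

/-- `ρ₁` is the Gram matrix of the one-hole vectors `c_j ψ`, hence positive semidefinite (for
every Fock vector `ψ`; no particle-number or normalisation hypothesis is needed).
Yang, Rev. Mod. Phys. 34 (1962) 694, §3; Xiang–Wu (2022), eq. (1.69). [folklore] -/
theorem oneParticleRDM_posSemidef (ψ : Fock ι) : (oneParticleRDM ψ).PosSemidef := by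
  let B : Matrix (Finset ι) ι ℂ := Matrix.of fun s j => (annihilation j *ᵥ ψ) s
  have hB : oneParticleRDM ψ = Bᴴ * B := by
    ext i j
    rw [oneParticleRDM_eq_star_dotProduct, Matrix.mul_apply]
    simp [B, dotProduct]
  rw [hB]
  exact Matrix.posSemidef_conjTranspose_mul_self B

/-- `tr ρ₁ = Σ_i ‖c_i ψ‖² = N ‖ψ‖² = N` for a normalised `N`-particle vector (`Σ_i c†_i c_i` is
the number operator). Yang, Rev. Mod. Phys. 34 (1962) 694, §3. [folklore] -/
theorem oneParticleRDM_trace {N : ℕ} {ψ : Fock ι} (hψ : IsNParticle N ψ)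
    (hnorm : star ψ ⬝ᵥ ψ = 1) : (oneParticleRDM ψ).trace = N := by
  simp only [Matrix.trace, Matrix.diag_apply, oneParticleRDM_eq_star_dotProduct]
  rw [PosSemidefTrace.sum_star_annihilation_mulVec_dotProduct_of_isNParticle hψ, hnorm, mul_one]

/-- **Discharge of the named fact `oneParticleRDM_posSemidef_trace`.** For a normalised
`N`-particle Fock vector `ψ`, Yang's one-particle reduced density matrix
`ρ₁(i, j) = ⟨ψ, c†_i c_j ψ⟩` is positive semidefinite (it is the Gram matrix of the one-hole
vectors `c_j ψ`, `oneParticleRDM_posSemidef`) and `tr ρ₁ = Σ_i ⟨ψ, n_i ψ⟩ = N`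
(`oneParticleRDM_trace`). Yang, Rev. Mod. Phys. 34 (1962) 694, §3 (the reduced density
matrices are positive semidefinite Hermitian, normalised to `Tr ρ₁ = N`). [cite: Yang1962, §3] -/
theorem oneParticleRDM_posSemidef_trace_holds : oneParticleRDM_posSemidef_trace (ι := ι) :=
  fun _N ψ hψ hnorm => ⟨oneParticleRDM_posSemidef ψ, oneParticleRDM_trace hψ hnorm⟩

end Literature.MathematicalPhysics.QuantumLattice
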